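import Literature.MathematicalPhysics.QuantumLattice.StabilityLightConeSumProofs
import Literature.MathematicalPhysics.QuantumLattice.StabilitySmoothingTailsProofs
import HarnessLib

/-!
# The light-cone lemma: all perturbation terms against one evolved local observable

Top-down layer (seat B) of the formalisation of the Michalakis–Zwolak stability theorem
(hubbard.S19, `Literature.MathematicalPhysics.QuantumLattice.michalakis_zwolak`), the
Lieb–Robinson input of MZ13 Lemma 1 (v) (arXiv:1109.1588 p. 11: the commutators
`[V_v(k), τ_{t'}(O_u(r))]` "decay rapidly in the distance between `b_v(k)` and `b_u(r)` … for
`k ≥ r'/2` we may use the simple bound"): for `Φ` local of range `r₀` (`‖Φ Z‖ ≤ 1`), `V` local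
of range `r` (`‖V Z‖ ≤ 1`), `Q ∈ 𝔄_{b_x(R)}` and every time `u`,
`Σ_{Z'} ‖[V Z', τ_u^{Σ Φ}(Q)]‖ ≤ ‖Q‖ A (1+|u|)^{d+1}` with `A` depending on `d, κ, r₀, r, R`
only (`exists_lightCone_comm_bound`). Each non-zero `V Z'` sits in a ball `b_v(r)`; if
`dist(x, v) = D ≥ r + R + 1 + r₀` then `[V Z', τ_u(Q)] = [V Z', τ_u(Q) − 𝔼(τ_u(Q))]` for the
localisation of `τ_u(Q)` onto `b_x(D − r − 1)`, whose error is the Lieb–Robinson tail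
(`norm_heisenbergEvolution_sub_twirl_le`, `norm_comm_heisenbergEvolution_ball_le`); the sum over
`v` is then the shell sum of `exists_lightCone_sum_bound`. No definitions, no named facts
(theorems only).
-/

noncomputable section

open Matrix Complex Finset
open scoped Matrix.Norms.L2Operator

namespace Literature.MathematicalPhysics.QuantumLattice

open Literature.Probability.LatticeModels

section Geometry

variable {d L : ℕ} [NeZero L] {κ : Type*} [Fintype κ]

/-- A region inside `b_v(r)` with `dist(x, v) = D` misses the ball `b_x(ρ)` whenever `ρ + r < D`.
[folklore] -/
theorem subset_compl_cellBall_of_far [DecidableEq κ] (x v : TorusSite d L)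
    {Z : Finset (TorusSite d L × κ)} {r ρ : ℕ}
    (hZ : Z ⊆ cellBall v r) (hD : ρ + r < torusDist x v) :
    Z ⊆ (cellBall x ρ : Finset (TorusSite d L × κ))ᶜ := by
  intro z hz
  rw [mem_compl, mem_cellBall_iff, not_le]
  have h1 : torusDist v z.1 ≤ r := mem_cellBall_iff.1 (hZ hz)
  have h2 : torusDist x v ≤ torusDist x z.1 + torusDist z.1 v := torusDist_triangle_holds x z.1 v
  rw [torusDist_comm_holds z.1 v] at h2
  omega

/-- **Summing a radial profile over the sites of the torus**: for `f ≥ 0`,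
`Σ_v f(dist(x,v)) ≤ Σ_{D ≤ L} (2D+1)^d f(D)`. [folklore] -/
theorem sum_radial_le_ball (x : TorusSite d L) {f : ℕ → ℝ} (hf : ∀ D, 0 ≤ f D) :
    ∑ v : TorusSite d L, f (torusDist x v) ≤
      ∑ D ∈ range (L + 1), (2 * (D : ℝ) + 1) ^ d * f D := by
  classical
  have hmaps : ∀ v ∈ (univ : Finset (TorusSite d L)), torusDist x v ∈ range (L + 1) := fun v _ =>
    mem_range.mpr (Nat.lt_succ_of_le ((torusDist_le_half x v).trans (Nat.div_le_self L 2)))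
  rw [← sum_fiberwise_of_maps_to hmaps]
  refine sum_le_sum fun D _ => ?_
  have hcard : ((univ.filter fun v : TorusSite d L => torusDist x v = D).card : ℝ) ≤
      (2 * (D : ℝ) + 1) ^ d := by
    have h1 : (univ.filter fun v : TorusSite d L => torusDist x v = D).card ≤ (torusBall x D).card :=
      card_le_card fun v hv => by
        simp only [mem_filter, mem_univ, true_and] at hv
        exact mem_torusBall_iff.mpr hv.le
    have h2 := card_torusBall_le x D
    exact_mod_cast h1.trans h2
  calc ∑ v ∈ univ.filter (fun v : TorusSite d L => torusDist x v = D), f (torusDist x v)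
      = ∑ v ∈ univ.filter (fun v : TorusSite d L => torusDist x v = D), f D := by
        refine sum_congr rfl fun v hv => ?_
        simp only [mem_filter, mem_univ, true_and] at hv
        rw [hv]
    _ = ((univ.filter fun v : TorusSite d L => torusDist x v = D).card : ℝ) * f D := by
        rw [sum_const, nsmul_eq_mul]
    _ ≤ (2 * (D : ℝ) + 1) ^ d * f D := mul_le_mul_of_nonneg_right hcard (hf D)

end Geometry

section LightCone

variable (d : ℕ) (κ : Type*) [Fintype κ] [DecidableEq κ] (q : ℕ)

set_option maxHeartbeats 1600000 in
/-- **The light-cone lemma (Lieb–Robinson input of MZ13 Lemma 1 (v)).** For every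
`r₀ r R : ℕ` there is `A ≥ 0` such that on every torus, for local `Φ` of range `r₀` with
`‖Φ Z‖ ≤ 1`, local `V` of range `r` with `‖V Z‖ ≤ 1`, every centre `x`, every
`Q ∈ 𝔄_{b_x(R)}` and every real `u`:
`Σ_{Z'} ‖V Z' τ_u(Q) − τ_u(Q) V Z'‖ ≤ ‖Q‖ A (1 + |u|)^{d+1}`, `τ_u = τ_u^{Σ_Z Φ Z}`.
[cite: MichalakisZwolakCMP2013, §5.1 proof of Lemma 1 (v) (arXiv:1109.1588 p. 11)] -/
theorem exists_lightCone_comm_bound (r₀ r R : ℕ) :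
    ∃ A : ℝ, 0 ≤ A ∧ ∀ {L : ℕ} [NeZero L] {Φ V : Interaction (TorusSite d L × κ) q}, Φ.IsLocal →
      (∀ Z, r₀ < torusDiam Z → Φ Z = 0) → (∀ Z, ‖Φ Z‖ ≤ 1) → V.IsLocal →
      (∀ Z, r < torusDiam Z → V Z = 0) → (∀ Z, ‖V Z‖ ≤ 1) →
      ∀ (x : TorusSite d L) {Q : Op (TorusSite d L × κ) q}, IsSupportedOn Q (cellBall x R) →
      ∀ u : ℝ,
      ∑ Z' : Finset (TorusSite d L × κ),
          ‖V Z' * heisenbergEvolution (∑ Z, Φ Z) u Q - heisenbergEvolution (∑ Z, Φ Z) u Q * V Z'‖ ≤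
        ‖Q‖ * (A * (1 + |u|) ^ (d + 1)) := by
  classical
  -- uniform constants
  set J : ℝ := (2 : ℝ) ^ ((2 * r₀ + 1) ^ d * Fintype.card κ) with hJ
  have hJ0 : 0 ≤ J := by positivity
  set Vc : ℕ := (2 * r₀ + 1) ^ d * Fintype.card κ + 1 with hVc
  have hVc1 : 1 ≤ Vc := Nat.le_add_left 1 _
  set NR : ℕ := (2 * R + 1) ^ d * Fintype.card κ with hNR
  set Nr : ℝ := (2 : ℝ) ^ ((2 * r + 1) ^ d * Fintype.card κ) with hNr
  have hNr0 : 0 ≤ Nr := by positivity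
  set c : ℝ := 2 * Real.exp 1 * Vc * J with hc
  have hc0 : 0 ≤ c := by positivity
  set K : ℝ := (NR : ℝ) / Vc * Real.exp 1 with hK
  have hK0 : 0 ≤ K := by positivity
  obtain ⟨A₀, hA₀0, hA₀⟩ := exists_lightCone_sum_bound d r₀ (r + R) hK0 hc0
  refine ⟨4 * Nr * A₀, by positivity, ?_⟩
  intro L _ Φ V hΦ hΦr hΦn hV hVr hVn x Q hQ u
  -- the interaction data at this volume
  have hJΦ : ∀ y : TorusSite d L × κ, ∑ Z ∈ univ.filter (fun Z : Finset (TorusSite d L × κ) => y ∈ Z),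
      ‖Φ Z‖ ≤ J := fun y => sum_norm_filter_mem_le_two_pow hΦr hΦn y
  have hVΦ : ∀ Z, Φ Z ≠ 0 → #Z ≤ Vc := fun Z hZ =>
    (card_le_of_torusDiam_le (not_lt.mp fun h => hZ (hΦr Z h))).trans (Nat.le_succ _)
  have hH : (∑ Z, Φ Z).IsHermitian := by
    rw [← localHamiltonian_univ_eq_sum]; exact localHamiltonian_isHermitian hΦ univ
  generalize hT : heisenbergEvolution (∑ Z, Φ Z) u Q = T
  have hTn : ‖T‖ = ‖Q‖ := by rw [← hT]; exact norm_heisenbergEvolution_holds hH u Q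
  -- the shell profile
  obtain ⟨g, hg⟩ : ∃ g : ℕ → ℝ, ∀ D, g D = if r + R + 1 + r₀ ≤ D then
      min 1 (K * Real.exp (-(((D : ℝ) - (r + R : ℕ)) / ((r₀ : ℝ) + 1)) + c * |u|)) else 1 :=
    ⟨_, fun D => rfl⟩
  have hg0 : ∀ D, 0 ≤ g D := fun D => by
    rw [hg]; split_ifs
    · exact le_min zero_le_one (by positivity)
    · exact zero_le_one
  have hg1 : ∀ D, g D ≤ 1 := fun D => by
    rw [hg]; split_ifs
    · exact min_le_left _ _
    · exact le_rfl
  -- the tail of `τ_u(Q)` at radius `ρ = D − r − 1 ≥ R + r₀`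
  have htail : ∀ D : ℕ, r + R + 1 + r₀ ≤ D →
      ‖T - twirl (cellBall x (D - r - 1) : Finset (TorusSite d L × κ))ᶜ T‖ ≤ 2 * ‖Q‖ * g D := by
    intro D hD
    set ℓ : ℕ := D - r - 1 - R with hℓ
    have hℓr : r₀ ≤ ℓ := by omega
    have hρ : D - r - 1 = R + ℓ := by omega
    rw [hρ]
    have hlr := norm_heisenbergEvolution_sub_twirl_le hH Q u (cellBall x (R + ℓ))
      (ε := 2 * ‖Q‖ * ((NR : ℝ) / Vc *
        Real.exp (-(1 * (((ℓ + 1) / (r₀ + 1) : ℕ) : ℝ)) + 2 * Real.exp 1 * Vc * J * |u|)))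
      (fun U hU hUu => by
        have h := norm_comm_heisenbergEvolution_ball_le hΦ hΦr hJ0 hJΦ hVc1 hVΦ x hℓr hQ
          (Y := (cellBall x (R + ℓ) : Finset (TorusSite d L × κ))ᶜ) disjoint_compl_right hU
          zero_le_one u
        rw [localHamiltonian_univ_eq_sum] at h
        refine h.trans ?_
        have hU1 : ‖U‖ ≤ 1 := by
          rcases subsingleton_or_nontrivial (Op (TorusSite d L × κ) q) with hs | hs
          · rw [Subsingleton.elim U 0, norm_zero]; exact zero_le_one
          · exact (CStarRing.norm_of_mem_unitary hUu).le
        have hcard : (#(cellBall x R : Finset (TorusSite d L × κ)) : ℝ) ≤ NR := by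
          exact_mod_cast card_cellBall_le x R
        have hexp0 : 0 ≤ Real.exp (-(1 * (((ℓ + 1) / (r₀ + 1) : ℕ) : ℝ)) +
            2 * Real.exp 1 * Vc * J * |u|) := (Real.exp_pos _).le
        have hVr : (0 : ℝ) < Vc := by exact_mod_cast hVc1
        have h2Q : (0 : ℝ) ≤ 2 * ‖Q‖ := by positivity
        calc 2 * ‖Q‖ * ‖U‖ * (#(cellBall x R : Finset (TorusSite d L × κ)) / Vc) *
              Real.exp (-(1 * (((ℓ + 1) / (r₀ + 1) : ℕ) : ℝ)) + 2 * Real.exp 1 * Vc * J * |u|)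
            ≤ 2 * ‖Q‖ * 1 * ((NR : ℝ) / Vc) *
              Real.exp (-(1 * (((ℓ + 1) / (r₀ + 1) : ℕ) : ℝ)) + 2 * Real.exp 1 * Vc * J * |u|) :=
              mul_le_mul_of_nonneg_right (mul_le_mul (mul_le_mul_of_nonneg_left hU1 h2Q)
                (div_le_div_of_nonneg_right hcard hVr.le) (div_nonneg (Nat.cast_nonneg _) hVr.le)
                (mul_nonneg h2Q zero_le_one)) hexp0
          _ = _ := by ring)
    rw [hT] at hlr
    refine hlr.trans ?_
    -- `min(2‖Q‖ X, 2‖Q‖) = 2‖Q‖ min(X, 1) ≤ 2‖Q‖ g D`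
    have hgD : g D = min 1 (K * Real.exp (-(((D : ℝ) - (r + R : ℕ)) / ((r₀ : ℝ) + 1)) + c * |u|)) := by
      rw [hg, if_pos hD]
    rw [hgD]
    have hfloor : Real.exp (-(1 * (((ℓ + 1) / (r₀ + 1) : ℕ) : ℝ)) + 2 * Real.exp 1 * Vc * J * |u|) ≤
        Real.exp 1 * Real.exp (-(((D : ℝ) - (r + R : ℕ)) / ((r₀ : ℝ) + 1)) + c * |u|) := by
      rw [← Real.exp_add]
      refine Real.exp_le_exp.mpr ?_
      have hρ0 : (0 : ℝ) < (r₀ : ℝ) + 1 := by positivity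
      -- `⌊(ℓ+1)/(r₀+1)⌋ ≥ (ℓ+1)/(r₀+1) − 1` and `ℓ + 1 = D − (r+R)`
      have h1 : (((D : ℝ) - (r + R : ℕ)) / ((r₀ : ℝ) + 1)) - 1 ≤ (((ℓ + 1) / (r₀ + 1) : ℕ) : ℝ) := by
        have hq := Nat.div_add_mod (ℓ + 1) (r₀ + 1)
        have hm := Nat.mod_lt (ℓ + 1) (Nat.succ_pos r₀)
        have hD' : ((D : ℝ) - (r + R : ℕ)) = ((ℓ + 1 : ℕ) : ℝ) := by
          have : D - (r + R) = ℓ + 1 := by omega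
          rw [← this, Nat.cast_sub (by omega)]
        rw [hD', div_sub_one hρ0.ne', div_le_iff₀ hρ0]
        have h3 : ((ℓ + 1 : ℕ) : ℝ) = ((r₀ + 1 : ℕ) : ℝ) * (((ℓ + 1) / (r₀ + 1) : ℕ) : ℝ) +
            (((ℓ + 1) % (r₀ + 1) : ℕ) : ℝ) := by exact_mod_cast hq.symm
        have h4 : (((ℓ + 1) % (r₀ + 1) : ℕ) : ℝ) < ((r₀ + 1 : ℕ) : ℝ) := by exact_mod_cast hm
        push_cast at h3 h4 ⊢
        nlinarith
      rw [hc]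
      linarith
    have hX : 2 * ‖Q‖ * ((NR : ℝ) / Vc *
        Real.exp (-(1 * (((ℓ + 1) / (r₀ + 1) : ℕ) : ℝ)) + 2 * Real.exp 1 * Vc * J * |u|)) ≤
        2 * ‖Q‖ * (K * Real.exp (-(((D : ℝ) - (r + R : ℕ)) / ((r₀ : ℝ) + 1)) + c * |u|)) := by
      refine mul_le_mul_of_nonneg_left ?_ (by positivity)
      calc (NR : ℝ) / Vc * Real.exp (-(1 * (((ℓ + 1) / (r₀ + 1) : ℕ) : ℝ)) + 2 * Real.exp 1 * Vc * J * |u|)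
          ≤ (NR : ℝ) / Vc * (Real.exp 1 *
              Real.exp (-(((D : ℝ) - (r + R : ℕ)) / ((r₀ : ℝ) + 1)) + c * |u|)) :=
            mul_le_mul_of_nonneg_left hfloor (by positivity)
        _ = K * Real.exp (-(((D : ℝ) - (r + R : ℕ)) / ((r₀ : ℝ) + 1)) + c * |u|) := by
            rw [hK]; ring
    have h2Q : (0 : ℝ) ≤ 2 * ‖Q‖ := by positivity
    calc min (2 * ‖Q‖ * ((NR : ℝ) / Vc *
          Real.exp (-(1 * (((ℓ + 1) / (r₀ + 1) : ℕ) : ℝ)) + 2 * Real.exp 1 * Vc * J * |u|))) (2 * ‖Q‖)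
        ≤ min (2 * ‖Q‖ * (K * Real.exp (-(((D : ℝ) - (r + R : ℕ)) / ((r₀ : ℝ) + 1)) + c * |u|)))
            (2 * ‖Q‖) := min_le_min hX le_rfl
      _ = 2 * ‖Q‖ * min 1 (K * Real.exp (-(((D : ℝ) - (r + R : ℕ)) / ((r₀ : ℝ) + 1)) + c * |u|)) := by
          rw [mul_min_of_nonneg _ _ h2Q, mul_one, min_comm]
  -- centres of the perturbation terms
  set x₀ : TorusSite d L := fun _ => 0 with hx₀
  set cV : Finset (TorusSite d L × κ) → TorusSite d L :=
    fun Z => if h : Z.Nonempty then h.choose.1 else x₀ with hcVdef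
  have hcV : ∀ Z, V Z ≠ 0 → Z ⊆ cellBall (cV Z) r := by
    intro Z hZ
    have hRz : torusDiam Z ≤ r := not_lt.mp fun h => hZ (hVr Z h)
    by_cases h : Z.Nonempty
    · have hc : cV Z = h.choose.1 := by simp only [hcVdef, dif_pos h]
      rw [hc]; exact subset_cellBall_of_mem_of_torusDiam_le h.choose_spec hRz
    · rw [Finset.not_nonempty_iff_eq_empty.mp h]; exact Finset.empty_subset _
  -- per-term bound: `‖[V Z', T]‖ ≤ 4‖Q‖ g(dist(x, cV Z'))`
  have hterm : ∀ Z', ‖V Z' * T - T * V Z'‖ ≤ 4 * ‖Q‖ * g (torusDist x (cV Z')) := by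
    intro Z'
    by_cases hZ : V Z' = 0
    · rw [hZ, Matrix.zero_mul, Matrix.mul_zero, sub_zero, norm_zero]
      exact mul_nonneg (by positivity) (hg0 _)
    generalize hDdef : torusDist x (cV Z') = D
    by_cases hD : r + R + 1 + r₀ ≤ D
    · -- far: insert the localisation of `T`
      generalize hM : twirl (cellBall x (D - r - 1) : Finset (TorusSite d L × κ))ᶜ T = M
      have hMs : IsSupportedOn M (cellBall x (D - r - 1)) := by
        rw [← hM]; exact isSupportedOn_twirl_compl _ T
      have hZ's : IsSupportedOn (V Z') ((cellBall x (D - r - 1) : Finset (TorusSite d L × κ))ᶜ) :=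
        IsSupportedOn.mono_holds (hV.isSupportedOn Z')
          (subset_compl_cellBall_of_far x (cV Z') (hcV Z' hZ) (by omega))
      have hcomm : V Z' * M = M * V Z' :=
        (commute_of_disjoint_holds hZ's hMs disjoint_compl_left).eq
      have hred : V Z' * T - T * V Z' = V Z' * (T - M) - (T - M) * V Z' := by
        rw [Matrix.mul_sub, Matrix.sub_mul, hcomm]; abel
      have htail' : ‖T - M‖ ≤ 2 * ‖Q‖ * g D := by rw [← hM]; exact htail D hD
      rw [hred]
      calc ‖V Z' * (T - M) - (T - M) * V Z'‖ ≤ ‖V Z' * (T - M)‖ + ‖(T - M) * V Z'‖ := norm_sub_le _ _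
        _ ≤ ‖V Z'‖ * ‖T - M‖ + ‖T - M‖ * ‖V Z'‖ := add_le_add (norm_mul_le _ _) (norm_mul_le _ _)
        _ ≤ 1 * ‖T - M‖ + ‖T - M‖ * 1 :=
            add_le_add (mul_le_mul_of_nonneg_right (hVn Z') (norm_nonneg _))
              (mul_le_mul_of_nonneg_left (hVn Z') (norm_nonneg _))
        _ = 2 * ‖T - M‖ := by ring
        _ ≤ 2 * (2 * ‖Q‖ * g D) := mul_le_mul_of_nonneg_left htail' (by norm_num)
        _ = 4 * ‖Q‖ * g D := by ring
    · -- near: the trivial bound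
      have hgD : g D = 1 := by rw [hg, if_neg hD]
      rw [hgD, mul_one]
      calc ‖V Z' * T - T * V Z'‖ ≤ ‖V Z' * T‖ + ‖T * V Z'‖ := norm_sub_le _ _
        _ ≤ ‖V Z'‖ * ‖T‖ + ‖T‖ * ‖V Z'‖ := add_le_add (norm_mul_le _ _) (norm_mul_le _ _)
        _ ≤ 1 * ‖T‖ + ‖T‖ * 1 :=
            add_le_add (mul_le_mul_of_nonneg_right (hVn Z') (norm_nonneg _))
              (mul_le_mul_of_nonneg_left (hVn Z') (norm_nonneg _))
        _ = 2 * ‖Q‖ := by rw [hTn]; ring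
        _ ≤ 4 * ‖Q‖ := by linarith [norm_nonneg Q]
  -- sum over the terms: group by centre (at most `Nr` non-zero terms per centre)
  have hsum1 : ∑ Z' : Finset (TorusSite d L × κ), ‖V Z' * T - T * V Z'‖ ≤
      ∑ v : TorusSite d L, Nr * (4 * ‖Q‖ * g (torusDist x v)) := by
    have h1 : ∑ Z' : Finset (TorusSite d L × κ), ‖V Z' * T - T * V Z'‖ =
        ∑ Z' ∈ univ.filter (fun Z' : Finset (TorusSite d L × κ) => V Z' ≠ 0), ‖V Z' * T - T * V Z'‖ := by
      symm
      refine sum_filter_of_ne fun Z' _ hne hV0 => hne ?_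
      rw [hV0, Matrix.zero_mul, Matrix.mul_zero, sub_zero, norm_zero]
    rw [h1, ← sum_fiberwise_of_maps_to (g := cV) (t := (univ : Finset (TorusSite d L)))
      (fun Z' _ => mem_univ _)]
    refine sum_le_sum fun v _ => ?_
    set Sv := (univ.filter (fun Z' : Finset (TorusSite d L × κ) => V Z' ≠ 0)).filter
      (fun Z' => cV Z' = v) with hSv
    have hcardv : (Sv.card : ℝ) ≤ Nr := by
      have h2 : ∀ Z' ∈ Sv, Z' ⊆ cellBall v r := by
        intro Z' hZ'
        simp only [hSv, mem_filter, mem_univ, true_and] at hZ'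
        rw [← hZ'.2]; exact hcV Z' hZ'.1
      have := card_filter_subset_le_two_pow v r Sv h2
      rw [hNr]; exact_mod_cast this
    calc ∑ Z' ∈ Sv, ‖V Z' * T - T * V Z'‖ ≤ ∑ Z' ∈ Sv, 4 * ‖Q‖ * g (torusDist x v) := by
          refine sum_le_sum fun Z' hZ' => ?_
          simp only [hSv, mem_filter, mem_univ, true_and] at hZ'
          rw [← hZ'.2]; exact hterm Z'
      _ = Sv.card * (4 * ‖Q‖ * g (torusDist x v)) := by rw [sum_const, nsmul_eq_mul]
      _ ≤ Nr * (4 * ‖Q‖ * g (torusDist x v)) :=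
          mul_le_mul_of_nonneg_right hcardv (by have := hg0 (torusDist x v); positivity)
  have hsum2 : ∑ v : TorusSite d L, Nr * (4 * ‖Q‖ * g (torusDist x v)) ≤
      Nr * (4 * ‖Q‖) * (A₀ * (1 + |u|) ^ (d + 1)) := by
    have h1 := sum_radial_le_ball x (f := fun D => g D) hg0
    have h2 : ∑ D ∈ range (L + 1), (2 * (D : ℝ) + 1) ^ d * g D ≤ A₀ * (1 + |u|) ^ (d + 1) := by
      have h := hA₀ (L + 1) u
      simp only [← hg] at h
      exact h
    calc ∑ v : TorusSite d L, Nr * (4 * ‖Q‖ * g (torusDist x v))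
        = Nr * (4 * ‖Q‖) * ∑ v : TorusSite d L, g (torusDist x v) := by
          rw [mul_sum]; refine sum_congr rfl fun v _ => ?_; ring
      _ ≤ Nr * (4 * ‖Q‖) * ∑ D ∈ range (L + 1), (2 * (D : ℝ) + 1) ^ d * g D :=
          mul_le_mul_of_nonneg_left h1 (by positivity)
      _ ≤ Nr * (4 * ‖Q‖) * (A₀ * (1 + |u|) ^ (d + 1)) :=
          mul_le_mul_of_nonneg_left h2 (by positivity)
  calc ∑ Z' : Finset (TorusSite d L × κ), ‖V Z' * T - T * V Z'‖
      ≤ Nr * (4 * ‖Q‖) * (A₀ * (1 + |u|) ^ (d + 1)) := hsum1.trans hsum2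
    _ = ‖Q‖ * (4 * Nr * A₀ * (1 + |u|) ^ (d + 1)) := by ring

end LightCone

end Literature.MathematicalPhysics.QuantumLattice
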